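import Summits.BirchSwinnertonDyer.BirchSwinnertonDyer.Theorems.KatoDescentTamePotSupersingularJetchevIrreducibleCoreVertexNamedFacts
import HarnessLib

/-!
# Crux X₄ `TprimeHeegnerUpperOfManinUnit` (stmt-BirchSwinnertonDyer-23738; TQMP r4 / TQS r303), line `rows_of_manin_unit` v2
# (3c59fc8b80b3), research stub Σ `stub_sigmaIrreducibleOptimalRows`: THE JETCHEV DIVISIBILITY READING IS CARRIER-BLIND —
# `p^s ∣ P_n` for `s ≤ ord_p c_q(E)` at ANY prime `q ∣ N_E` (multiplicative OR additive, `q = p` allowed) from the potss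
# 20165 chain's registered reading S2′ (`stub_prop52IrredP`, McCallum Prop. 5.2 irreducible, VERBATIM) and THREE NAMED
# LITERATURE FACTS {Gross 1991 Prop. 3.7 (2), Poitou–Tate for the tree's Selmer structures, [GZ86 III (3.1)] image-free}

HONEST FRAMING. Theorems only; helper file (`--supports stmt-BirchSwinnertonDyer-23738 --as helper`, leafhand
`leafhand-bsd-tamequarticmaninpa-5` g0, 2026-08-31, serve-list brief v2 «S2-add» of the route pen); no definition, no named fact,
no `sorry`; CONDITIONAL on every displayed input; nothing is booked, no stub is closed BY NAME, no item is closed, BSD is proved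
for no curve. Fourth companion of `…IrreducibleRows` (p823764) / `…Composition` (p823868) / `…MonoCarrier` (p824349) /
`…SigmaTight` (p826123) / `…SigmaMinf` (p826193).

WHY. On the (t′) rows Σ (global `3^{s′}`-divisibility of the derived Heegner points to depth `ord₃ ∏_ℓ c_ℓ(E)`) was known to be
reading-grade on the MONO-MULTIPLICATIVE-CARRIER rows (route RHP's item 27492 `JetchevDivisibilityReadingS2` BY NAME, whose text
carries the binders «`q ∥ N_E`», «`q ≠ p`», «`p ∤ c_p`», «`0 ≤ ord_p j`», «every Tamagawa-`p` carrier multiplicative»), and was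
booked OPEN on the rows whose unique Tamagawa-`3` carrier is an ADDITIVE prime `q ≠ 3` of Kodaira type `IV`/`IV*` ((M2) of the
census d4157784e9a72e06). READING THE KERNEL of cell bsd-potss's 20165 chain shows that NONE of those five binders is used below
the displayed statement: the node `JetchevIrreducibleReadingThm52Gross1991.h63IRowObjectsAddv_of_poitouTate_of_GZ31g_of_prop47P2`
(p547908) introduces them anonymously, and the bridge `JetchevIrreducibleCoreVertex.divisibilityIrredAddv_…` (p551527) only
forwards them to the node. What the kernel uses at the carrier is exactly: a place `v₀ ∣ q` of `K` with `τ v₀ ≠ v₀` (any `q ∣ N_E`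
splits in `K` under the Heegner hypothesis — `JET.exists_split_place_of_dvd`), minimality and `c_{v₀}(E/K) = c_q(E/ℚ_q)` over the
split completion (`JET.carrierRowData_of_split`), and `Φ_q(𝔽_q)` cyclic, which holds for EVERY Kodaira type as soon as an odd `p`
divides `c_q` (`JET.kodairaNeron_isAddCyclic_forall`: `I_n` cyclic, `IV`/`IV*` of prime order `3`, the others have `c_q ∣ 4`).
So Jetchev's Thm. 1.4 in the tree's irreducible additive-`p` reading holds AT ANY CARRIER:

* §1 `tamagawaExponent_le_mInf_of_dvd_level` — [J] Thm. 5.2 at a core vertex for the row objects, carrier = ANY prime `q ∣ N_E`: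
  `ord_p c_q(E) ≤ m_∞` ⟸ {Gross 3.7 (2) (feeding [McC] Prop. 4.4 (B) by `JetchevIrreducibleProp44.h47P2_of_prop37_2`, p541604),
  Poitou–Tate, [GZ86 III (3.1)] image-free (feeding the receptacle schema by `HeegnerE0ImageFree.forall_hGZ_of_Gross1991_imageFree`,
  p546756)} — p547908's proof VERBATIM with the idle binders deleted from the statement.
* §2 `divisibility_of_dvd_level_of_prop52IrredP_of_namedFacts` — **S2♭, the carrier-blind reading**: for `E/ℚ` non-CM globally
  minimal, `K` imaginary quadratic with `d_K ∉ {−3, −4}` and Heegner for `N_E`, `p` odd with `E[p]` irreducible and `p ∣ N_E`, the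
  conductor-`1` derived point non-torsion, ANY prime `q ∣ N_E` and `s ≤ ord_p c_q(E)`: every derived Heegner point `P_n` (`n`
  squarefree, Kolyvagin primes of index `≥ s`) is `p^s`-divisible in `E(K[n])` — from S2′ VERBATIM + the three named facts (the
  bridge p551527 re-run over §1; core vertices from `JetchevIrreducibleCoreVertex.coreVertexExistenceIrredP_lt_of_prop37_2_…`,
  p554747; ring class fields are number fields, `JET.numberField_ringClassField`). S2♭ specialises to 27492's text (drop nothing,
  add its five binders) and to crux 19941's S2p (carrier `q = p`).
The Heegner-frame form (`Koly.PDiv d p s` on a frame `(Dt, H.β, ι, P)`, the conductor-`1` datum with bottom point `P` being a tree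
theorem) and the TQMP consequences (Σ VERBATIM-restricted to ALL mono-carrier (t′) rows — multiplicative or additive carrier —, the
typed upper half there ⟸ PUB + S2′ + three facts + L₀, the r₁/r₂ binder form, and Jetchev's Thm. 1.4 `M_∞ ≥ m_max` in McCallum
currency) are the sequel file `…SigmaMonoCarrierRows` (§§1, 1b, 2–4 there); the onto face (print only) is `…SigmaOntoMonoCarrier`.

References: [cite: Jetchev2008, Thm. 1.4 and Cor. 1.5 (p. 812), Prop. 4.7, Prop. 4.9, Lemma 5.2, Prop. 5.3, Thm. 5.2 (p. 821), Rem. 6.2]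
[cite: McCallumLMS1991, §4 Prop. 4.4, §5 Prop. 5.2 (p. 304)] [cite: GrossLMS1991, §1 p. 235, Prop. 3.7 (2), §6 proof of Prop. 6.2 (1), p. 245]
[cite: GrossZagier1986, III (3.1)] [cite: MilneADT2006, Ch. I, Thm. 4.10(b)] [cite: Howard2004HeegnerKolyvagin, Prop. 2.1.9 (ii), Lemma 2.7.3]
[cite: SilvermanATAEC1994, Cor. IV.9.2 (d) with (b) (PDF p. 340), Table 4.1] [cite: CasselsFrohlichANT1967, Ch. VII Prop. 1.2 (ii)].

presearch (D-0021): `lean search 'anyCarrier|carrierBlind|of_dvd_level'` → none; the node/bridge/divisibility theorems of the tree all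
display «`q ∥ N`» (20165 face) or «`q = p`» (19941 face). corpus: Jetchev 2008 Thm. 1.4 is stated for `p ∤ N` and a prime `q ∣ N` with
`p ∣ c_q` of ANY reduction type ([corpus:Jetchev2008 p. 812]); the multiplicativity binder of 27492 is an artefact of the D-audit typing,
not of the source. galaxy: «Tamagawa|Kolyvagin divisibility» → Jetchev 2008 / BCGS 2026 only. Pure composition of tree theorems.
-/

set_option autoImplicit false
-- D-0017: single-problem summit, so `Summit.BirchSwinnertonDyer.BirchSwinnertonDyer.…` repeats a namespace BY DESIGN.
set_option linter.dupNamespace false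

noncomputable section

open scoped Classical NumberField Pointwise

open WeierstrassCurve IsDedekindDomain NumberField Field Literature.NumberTheory.EllipticCurves
  Literature.NumberTheory.EllipticCurves.ModularForms Literature.NumberTheory.EllipticCurves.Jetchev2008
  Literature.NumberTheory.EllipticCurves.Rank1Residual
  Literature.NumberTheory.GaloisRepresentations Literature.NumberTheory.GaloisCohomology
  Literature.NumberTheory.GaloisRepresentations.DiscreteGaloisModule
  Summit.BirchSwinnertonDyer.Rank1Residual Summit.BirchSwinnertonDyer.Rank1Residual.X11b
  Summit.BirchSwinnertonDyer.Rank1Residual.X11b.Three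
  Summit.BirchSwinnertonDyer.Rank1Residual.JET Summit.BirchSwinnertonDyer.Rank1Residual.JET.SelmerVocabulary
  Literature.NumberTheory.Automorphic
  Summit.BirchSwinnertonDyer.BirchSwinnertonDyer.Theorems
  Summit.BirchSwinnertonDyer.BirchSwinnertonDyer.Theorems.JetchevIrreducibleH63P2
  Summit.BirchSwinnertonDyer.BirchSwinnertonDyer.Theorems.JetchevIrreducibleReadingDivisibility
  Summit.BirchSwinnertonDyer.BirchSwinnertonDyer.Theorems.JetchevIrreducibleReadingDivisibilityPrimed

namespace Summit.BirchSwinnertonDyer.BirchSwinnertonDyer.Theorems.JetchevIrreducibleCarrierBlind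

/-! ## §1 [J] Thm. 5.2 at a core vertex, carrier = ANY prime `q ∣ N_E` -/

/-- **`ord_p c_q(E) ≤ m_∞` at a core vertex, for ANY prime `q ∣ N_E` (multiplicative or additive, `q = p` allowed), from THREE NAMED
LITERATURE FACTS.** Data: `W/ℚ` globally minimal, non-CM; `K` imaginary quadratic, `d_K ∉ {−3, −4}`, Heegner for `N_E`, `τ ≠ 1` in
`Aut(K/ℚ)`; `p` odd, `E[p]` irreducible, `p ∣ N_E`; a frame `(Dt, β, ι)`; a prime `q ∣ N_E`; McCallum's depth bookkeeping
`(mdiv, m)` and a core vertex `c` at level `k` with `m(c) = m_∞`, `k + m_∞ ≤ M(c)`, `ord_p c_q < k`, `m_∞ < k`. NAMED FACTS: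
`h37` Gross 1991 Prop. 3.7 (2) (→ [McC] Prop. 4.4 (B) irreducible, `JetchevIrreducibleProp44.h47P2_of_prop37_2`), `hPT` Poitou–Tate,
`hF1` [GZ86 III (3.1)] image-free (→ the receptacle schema, `HeegnerE0ImageFree.forall_hGZ_of_Gross1991_imageFree`). Proof = the node
`JetchevIrreducibleReadingThm52Gross1991.h63IRowObjectsAddv_of_poitouTate_of_GZ31g_of_prop47P2` (p547908) VERBATIM — that proof never
touches «`q ∥ N`», «`q ≠ p`», «`p ∤ c_p`», «`0 ≤ ord_p j`» or the global Tamagawa binder; at the carrier it uses the split place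
`v₀ ∣ q` (Heegner hypothesis), the split-completion row data, and `Φ_q` cyclic from `p ∣ c_q`, `p` odd (any Kodaira type).
CONDITIONAL; nothing asserted. [cite: Jetchev2008, Thm. 5.2 (p. 821) and proof, Thm. 1.4, Prop. 4.7, Prop. 4.9]
[cite: GrossLMS1991, Prop. 3.7 (2), §6 p. 245] [cite: SilvermanATAEC1994, Cor. IV.9.2 (d) (PDF p. 340)]
[cite: Howard2004HeegnerKolyvagin, Prop. 2.1.9 (ii), Lemma 2.7.3] [cite: MilneADT2006, Ch. I, Thm. 4.10(b)] -/
theorem tamagawaExponent_le_mInf_of_dvd_level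
    (h37 : GrossLMS1991.prop37_2_frobeniusCongruence)
    (hPT : ∀ (K : Type) [Field K] [NumberField K], poitouTate_selmerStructure_duality_conj K)
    (hF1 : Gross1991_heegnerPoint_sub_ratTorsion_mem_E0_imageFree)
    (W : WeierstrassCurve ℚ) [W.IsElliptic] [W.IsGloballyMinimal] [NeZero (W.conductorNorm ℤ)]
    (hcm : ¬ W.HasCM) (K : Type) [Field K] [NumberField K] (hK : IsImaginaryQuadratic K)
    (hD3 : NumberField.discr K ≠ -3) (hD4 : NumberField.discr K ≠ -4)
    (hH : SatisfiesHeegnerHypothesis (W.conductorNorm ℤ) K)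
    (τ : K ≃ₐ[ℚ] K) (hτ : τ ≠ 1)
    (p : ℕ) [Fact p.Prime] (hp2 : p ≠ 2) (hirr : W.HasIrreducibleModPGaloisRep p)
    (hpN : p ∣ W.conductorNorm ℤ)
    (Dt : ModularParametrizationData W (W.conductorNorm ℤ)) (β : ℤ) (ι : K →+* ℂ)
    [∀ j : ℕ, NumberField (ringClassField K ι j)]
    (q : ℕ) [Fact q.Prime] (hq : q ∣ W.conductorNorm ℤ)
    (mdiv m : {c : ℕ // Squarefree c ∧ ∀ ℓ ∈ c.primeFactors,
        Zhang2014.IsKolyvaginPrime (W.conductorNorm ℤ) W K p ℓ} → ℕ∞)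
    (hmdiv : ∀ c (u : ℕ), (u : ℕ∞) ≤ mdiv c ↔ ∀ d : KolyvaginHeegnerData Dt β ι c.1,
      ∃ Q : (W.baseChange (ringClassField K ι c.1)).toAffine.Point,
        ((p ^ u : ℕ) : ℤ) • Q = d.derivedPoint)
    (hm : ∀ c, m c = if mdiv c < Zhang2014.levelIndex W p c.1 then mdiv c else ⊤)
    (mInf k : ℕ) (c : {c : ℕ // Squarefree c ∧ ∀ ℓ ∈ c.primeFactors,
        Zhang2014.IsKolyvaginPrime (W.conductorNorm ℤ) W K p ℓ})
    (hk : 1 ≤ k) (hcore : Jetchev2008.IsGlobalCoreVertex W K ι τ p k c.1) (hmc : m c = mInf)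
    (hkM : (k : ℕ∞) + mInf ≤ Zhang2014.levelIndex W p c.1)
    (htk : padicValNat p ((W.baseChange ℚ_[q]).localTamagawaNumber ℤ_[q]) < k) (hik : mInf < k) :
    padicValNat p ((W.baseChange ℚ_[q]).localTamagawaNumber ℤ_[q]) ≤ mInf := by
  have hp : p.Prime := Fact.out
  have hD : NumberField.discr K < -4 := KolyvaginAssembly.discr_lt_neg_four hK ⟨hD3, hD4⟩
  -- trivial case: `p ∤ c_q`
  by_cases ht0 : padicValNat p ((W.baseChange ℚ_[q]).localTamagawaNumber ℤ_[q]) = 0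
  · rw [ht0]; exact Nat.zero_le _
  have hdvd : p ∣ (W.baseChange ℚ_[q]).localTamagawaNumber ℤ_[q] :=
    dvd_of_one_le_padicValNat (Nat.one_le_iff_ne_zero.mpr ht0)
  -- the carrier place `v₀ ∣ q`, split (Heegner hypothesis), and the transport of the row data — ANY reduction type at `q`
  obtain ⟨v₀, hv₀, hv₀N, hqv₀⟩ := exists_split_place_of_dvd K hK τ hτ hH q hq
  obtain ⟨hminK, hminP, hcEq, hc0, hcyc⟩ := carrierRowData_of_split W K q hK τ v₀ hv₀ hqv₀
  haveI := hminK
  haveI := hminP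
  haveI := hcyc (kodairaNeron_isAddCyclic_forall W q p hp2 hdvd)
  -- `τ² = 1`
  haveI : Algebra.IsQuadraticExtension ℚ K := ⟨hK.1⟩
  have hτ2 : τ * τ = 1 := by
    have hcard : Nat.card (K ≃ₐ[ℚ] K) = 2 := by rw [IsGalois.card_aut_eq_finrank, hK.1]
    obtain ⟨y, -, hyu⟩ := (Nat.card_eq_two_iff' (1 : K ≃ₐ[ℚ] K)).mp hcard
    have h1 : τ = y := hyu τ hτ
    have h2 : τ⁻¹ = y := hyu τ⁻¹ (inv_ne_one.mpr hτ)
    rw [mul_eq_one_iff_eq_inv]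
    exact h1.trans h2.symm
  -- instances at level `p^k`
  haveI : NeZero (p ^ k) := ⟨pow_ne_zero k hp.ne_zero⟩
  haveI : Finite (geomTorsion (W.baseChange K) ((p ^ k : ℕ) : ℤ)) :=
    finite_geomTorsion_of_neZero (W.baseChange K) (p ^ k)
  have hn : ((p ^ k : ℕ) : ℤ) ≠ 0 := by exact_mod_cast pow_ne_zero k hp.ne_zero
  -- the receptacle schema [GZ86 III (3.1)] at this frame, FED BY NAME from the image-free fact
  obtain ⟨n', hcop', hGZ'⟩ :=
    HeegnerE0ImageFree.forall_hGZ_of_Gross1991_imageFree hF1 W K hK hD3 hD4 hH p hp2 hirr Dt β ι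
  -- Kolyvagin data of the core vertex
  have hc0' : c.1 ≠ 0 := c.2.1.ne_zero
  have hkc : (k : ℕ∞) ≤ Zhang2014.levelIndex W p c.1 := le_trans le_self_add hkM
  have hcK : ∀ ℓ ∈ c.1.primeFactors, Zhang2014.IsKolyvaginPrime (W.conductorNorm ℤ) W K p ℓ ∧
      k ≤ Zhang2014.kolyvaginIndex W p ℓ := fun ℓ hℓ ↦
    ⟨c.2.2 ℓ hℓ, Zhang2014.natCast_le_levelIndex_iff.mp hkc ℓ hℓ⟩
  -- the exponent over `K_{v₀}` is the exponent over `ℚ_q`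
  have hfac : (((W.baseChange K).baseChange (v₀.adicCompletion K)).localTamagawaNumber
      (v₀.adicCompletionIntegers K)).factorization p =
      padicValNat p ((W.baseChange ℚ_[q]).localTamagawaNumber ℤ_[q]) := by
    rw [hcEq, Nat.factorization_def _ hp]
  have htk' : (((W.baseChange K).baseChange (v₀.adicCompletion K)).localTamagawaNumber
      (v₀.adicCompletionIntegers K)).factorization p < k := by rw [hfac]; exact htk
  -- the intrinsic transverse family (for `h49tr` from `htr` at level `cℓ`)
  obtain ⟨𝒯, h𝒯, hT⟩ := exists_localTransverseFamily W ι ((p ^ k : ℕ) : ℤ) hc0'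
  have key := tamagawaExponent_le_mInfty_of_localFacts_of_irreducible_namedPrint_of_prop47P2
    (JetchevIrreducibleProp44.h47P2_of_prop37_2 h37) W hcm K hK hD3 hD4 hH
    (hPT K) p hp2 hirr hpN Dt β ι τ hτ hτ2 hcop' hGZ' mdiv m hmdiv hm k hn c hk hcore mInf hmc hkM hik
    v₀ hv₀ hv₀N hc0 htk'
    (fun 𝒯' h𝒯' ↦ conjActPlace_mem_transverseFamily_forall W K hK ι τ hτ p k hp2 c.1 c.2.1 hcK 𝒯' h𝒯')
    (fun 𝒯' h𝒯' e hμ hadd₁ hadd₂ hgal halt hnondeg ↦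
      RingClassTransverse.localTransverseFamily_selfDual_forall W K hK hD3 hD4 ι p k hp2 c.1 c.2.1 hcK 𝒯' h𝒯'
        e hμ hadd₁ hadd₂ hgal halt hnondeg)
    (fun ℓ h1 h2 _ v hv hfix s hs ↦
      kolyvaginLocalTerm_of_poitouTate hPT W K hK τ hτ p k hp2 hk ℓ h1 h2 v hv hfix s hs)
    (fun d ℓ hℓ ↦ kolyvaginClass_mem_transverseKer W hK hD hp2 Dt β ι k c.2.1 hcK d hℓ)
    (fun ℓ h1 h2 h3 d' w hw ↦ by
      -- `h49tr` from `htr` at level `cℓ` through the reconciliation `hT`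
      have hl : ℓ.Prime := h1.1
      have hlc : ¬ ℓ ∣ c.1 := fun h ↦ h3 (Nat.mem_primeFactors.mpr ⟨hl, h, hc0'⟩)
      have hcl : Squarefree (c.1 * ℓ) :=
        (Nat.squarefree_mul ((Nat.Prime.coprime_iff_not_dvd hl).mpr hlc).symm).mpr ⟨c.2.1, hl.squarefree⟩
      have hpf : (c.1 * ℓ).primeFactors = c.1.primeFactors ∪ {ℓ} := by
        rw [Nat.primeFactors_mul hc0' hl.ne_zero, hl.primeFactors]
      have hcKℓ : ∀ l' ∈ (c.1 * ℓ).primeFactors, Zhang2014.IsKolyvaginPrime (W.conductorNorm ℤ) W K p l' ∧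
          k ≤ Zhang2014.kolyvaginIndex W p l' := by
        intro l' hl'
        rw [hpf, Finset.mem_union, Finset.mem_singleton] at hl'
        rcases hl' with h | rfl
        · exact hcK l' h
        · exact ⟨h1, h2⟩
      rw [← h𝒯 w]
      refine (hT _).mpr (fun l' hl' ↦ ?_) w hw
      exact kolyvaginClass_mem_transverseKer W hK hD hp2 Dt β ι k hcl hcKℓ d'
        (by rw [hpf]; exact Finset.mem_union_left _ hl'))
  rw [hfac] at key
  exact key

/-! ## §2 S2♭ — the carrier-blind divisibility reading from S2′ + three named facts -/

/-- **S2♭ (Jetchev 2008 Thm. 1.4 (ii), irreducible additive-`p` reading, CARRIER-BLIND) from the registered reading S2′ of crux 20165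
(`Sig.stub_prop52IrredP`, McCallum Prop. 5.2 irreducible, binder `h52I` VERBATIM) and THREE NAMED LITERATURE FACTS.** For `E/ℚ`
non-CM globally minimal, `K` imaginary quadratic with `d_K ∉ {−3, −4}` and Heegner for `N_E`, `p` odd, `E[p]` irreducible, `p ∣ N_E`,
a frame `(Dt, β, ι)` whose conductor-`1` derived point is non-torsion, ANY prime `q ∣ N_E` and `s ≤ ord_p c_q(E)`: every derived
Heegner point `P_n` (`n` squarefree, Kolyvagin primes of index `≥ s`) is `p^s`-divisible in `E(K[n])`. = route RHP's 27492 /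
20165's `Sig.S2DivisibilityIrredAddv` with the binders «`q ∥ N_E`», «`q ≠ p`», «`p ∤ c_p`», «`0 ≤ ord_p j`», «every Tamagawa-`p`
carrier multiplicative» DELETED and `Addv W p` weakened to `p ∣ N_E`. Proof = the bridge p551527 (`derivedPoint_divisible_of_prop52Row_of_section6_min`
over `prop52Row_of_prop52IrredP`, core vertices at the levels `k > m_∞` from `coreVertexExistenceIrredP_lt_of_prop37_2_of_poitouTate_of_Gross1991`)
closed by §1. CONDITIONAL on S2′ and the three facts; nothing asserted.
[cite: Jetchev2008, Thm. 1.4 (ii) (p. 812), Prop. 5.3 (p. 823), Thm. 5.2 (p. 821), Rem. 6.2] [cite: McCallumLMS1991, §5 Prop. 5.2 (p. 304)]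
[cite: GrossLMS1991, Prop. 3.7 (2), §6 p. 245] [cite: GrossZagier1986, III (3.1)] [cite: MilneADT2006, Ch. I, Thm. 4.10(b)] -/
theorem divisibility_of_dvd_level_of_prop52IrredP_of_namedFacts
    (h52I : ∀ (W : WeierstrassCurve ℚ) [W.IsElliptic] [W.IsGloballyMinimal] [NeZero (W.conductorNorm ℤ)],
        ¬ W.HasCM →
        ∀ (K : Type) [Field K] [NumberField K], IsImaginaryQuadratic K →
        NumberField.discr K ≠ -3 → NumberField.discr K ≠ -4 →
        SatisfiesHeegnerHypothesis (W.conductorNorm ℤ) K →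
        ∀ (p : ℕ) [Fact p.Prime], p ≠ 2 → W.HasIrreducibleModPGaloisRep p → (p : ℤ) ∣ W.conductorNorm ℤ →
        ∀ (Dt : ModularParametrizationData W (W.conductorNorm ℤ)) (β : ℤ) (ι : K →+* ℂ)
          (d₁ : KolyvaginHeegnerData Dt β ι 1), ¬ IsOfFinAddOrder d₁.derivedPoint →
        ∀ (r : ℕ), 0 < r →
        ∀ (Mr : ℕ),
          IsLeast {u : ℕ | ∃ (n : ℕ) (d : KolyvaginHeegnerData Dt β ι n), Squarefree n ∧
              n.primeFactors.card = r ∧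
              (∀ ℓ ∈ n.primeFactors, Zhang2014.IsKolyvaginPrime (W.conductorNorm ℤ) W K p ℓ ∧
                u + 1 ≤ Zhang2014.kolyvaginIndex W p ℓ) ∧
              (∃ Q : (W.baseChange (ringClassField K ι n)).toAffine.Point,
                ((p ^ u : ℕ) : ℤ) • Q = d.derivedPoint) ∧
              ¬ ∃ Q : (W.baseChange (ringClassField K ι n)).toAffine.Point,
                ((p ^ (u + 1) : ℕ) : ℤ) • Q = d.derivedPoint} Mr →
        ∀ (M : ℕ), Mr < M →
          ∃ (n : ℕ) (d : KolyvaginHeegnerData Dt β ι n), Squarefree n ∧ n.primeFactors.card = r ∧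
            (∀ ℓ ∈ n.primeFactors, Zhang2014.IsKolyvaginPrime (W.conductorNorm ℤ) W K p ℓ ∧
              M ≤ Zhang2014.kolyvaginIndex W p ℓ) ∧
            addOrderOf (d.kolyvaginClass (Fact.out : p.Prime) M) = p ^ (M - Mr) ∧
            (∃ Q : (W.baseChange (ringClassField K ι n)).toAffine.Point,
              ((p ^ Mr : ℕ) : ℤ) • Q = d.derivedPoint) ∧
            ¬ ∃ Q : (W.baseChange (ringClassField K ι n)).toAffine.Point,
              ((p ^ (Mr + 1) : ℕ) : ℤ) • Q = d.derivedPoint)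
    (h37 : GrossLMS1991.prop37_2_frobeniusCongruence)
    (hPT : ∀ (K : Type) [Field K] [NumberField K], poitouTate_selmerStructure_duality_conj K)
    (hF1 : Gross1991_heegnerPoint_sub_ratTorsion_mem_E0_imageFree) :
    ∀ (W : WeierstrassCurve ℚ) [W.IsElliptic] [W.IsGloballyMinimal] [NeZero (W.conductorNorm ℤ)],
      ¬ W.HasCM →
      ∀ (K : Type) [Field K] [NumberField K], IsImaginaryQuadratic K →
      NumberField.discr K ≠ -3 → NumberField.discr K ≠ -4 →
      SatisfiesHeegnerHypothesis (W.conductorNorm ℤ) K →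
      ∀ (p : ℕ) [Fact p.Prime], p ≠ 2 → W.HasIrreducibleModPGaloisRep p → p ∣ W.conductorNorm ℤ →
      ∀ (Dt : ModularParametrizationData W (W.conductorNorm ℤ)) (β : ℤ) (ι : K →+* ℂ)
        (d₁ : KolyvaginHeegnerData Dt β ι 1), ¬ IsOfFinAddOrder d₁.derivedPoint →
      ∀ (q : ℕ) [Fact q.Prime], q ∣ W.conductorNorm ℤ →
      ∀ (s : ℕ), s ≤ padicValNat p ((W.baseChange ℚ_[q]).localTamagawaNumber ℤ_[q]) →
      ∀ (n : ℕ) (d : KolyvaginHeegnerData Dt β ι n), Squarefree n →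
        (∀ ℓ ∈ n.primeFactors, Zhang2014.IsKolyvaginPrime (W.conductorNorm ℤ) W K p ℓ ∧
          s ≤ Zhang2014.kolyvaginIndex W p ℓ) →
        ∃ Q : (W.baseChange (ringClassField K ι n)).toAffine.Point,
          ((p ^ s : ℕ) : ℤ) • Q = d.derivedPoint := by
  intro W _ _ _ hcm K _ _ hK hD3 hD4 hH p _ hp2 hirr hpN Dt β ι d₁ hy q _ hqN s hs n d hn hℓ
  obtain ⟨τ, hτ⟩ := exists_algEquiv_ne_one_of_isImaginaryQuadratic K hK
  haveI : ∀ j : ℕ, NumberField (ringClassField K ι j) := numberField_ringClassField K hK ι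
  have hCVIlt := JetchevIrreducibleCoreVertex.coreVertexExistenceIrredP_lt_of_prop37_2_of_poitouTate_of_Gross1991
    h37 hPT hF1
  refine derivedPoint_divisible_of_prop52Row_of_section6_min W K p Dt β ι
    (prop52Row_of_prop52IrredP h52I W hcm K hK hD3 hD4 hH p hp2 hirr hpN Dt β ι d₁ hy) _ ?_ s hs n d hn hℓ
  intro mdiv m hchar hmdef mInf hmInf hKoly
  exact ⟨fun k c ↦ mInf < k → Jetchev2008.IsGlobalCoreVertex W K ι τ p k c.1,
    fun k c hk hmc hMc ↦ by
      by_cases hik : mInf < k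
      · obtain ⟨c', hcore, hM', hm'⟩ :=
          JetchevIrreducibleCoreVertex.exists_coreVertex_of_coreVertexExistenceIrredPlt hCVIlt W hcm K hK hD3 hD4 hH τ
            hτ p hp2 hirr hpN Dt β ι d₁ hy mdiv m hchar hmdef mInf k c hk hmc hMc hik
        exact ⟨c', fun _ ↦ hcore, hM', hm'⟩
      · exact ⟨c, fun h ↦ absurd h hik, by rw [add_comm]; exact hMc, le_of_eq hmc⟩,
    fun k c hk hcore hmc hMc htk hik ↦ tamagawaExponent_le_mInf_of_dvd_level h37 hPT hF1 W hcm K hK hD3 hD4 hH τ hτ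
      p hp2 hirr hpN Dt β ι q hqN mdiv m hchar hmdef mInf k c hk (hcore hik) hmc hMc htk hik⟩

end Summit.BirchSwinnertonDyer.BirchSwinnertonDyer.Theorems.JetchevIrreducibleCarrierBlind

end
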